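import Summits.ABC.ABC.Theses.FeketeScales
import Summits.ABC.ABC.Theorems.FeketeScalesSubmultOfRST

/-!
# The Stewart–Yu calibration — stub `stewartYu_slack_submult` of crux stmt-ABC-2160 `ScaleSubmultiplicativity` (line SketchIdeator3)

The crux inequality of `ScaleSubmultiplicativity` with the Stewart–Yu slack
`exp(κ (R₁R₂)^{1/3} (log R₁R₂)^3)` in place of the sub-power slack `exp((log R₁R₂)^θ)` holds for
all `R₁, R₂ ≥ 4` with `K = 16`, given the named fact abc.S06 (`stewart_yu`, Stewart–Yu 2001,
Theorem 1: `log c ≤ C · rad^{1/3} · (log rad)^3` for every abc triple).  With `κ := max C 1`, every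
abc triple with `rad ≤ R₁R₂` has `c = e^{log c} ≤ exp(κ (R₁R₂)^{1/3} (log R₁R₂)^3) ≤ 16 · exp(…) · c₁c₂`
for the dyadic witnesses `(1, 2ⁿ - 1, 2ⁿ)` at the scales `R₁`, `R₂`
(`SubmultOfRST.exists_triple_at_scale`; only `cᵢ ≥ 1` is used).  This is the unconditional end
(calibration rung) of the regularity hierarchy of line SketchIdeator3 (BarrierNotesIdeator3 §A9).
[cite: StewartYu2001, Theorem 1]
-/

-- `Summit.<Summit>.<Problem>` is the mandated summit-side namespace (CONVENTIONS §2); for the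
-- single-conjunct summit `ABC` the two coincide, so the duplicate `ABC.ABC` is deliberate.
set_option linter.dupNamespace false

namespace Summit.ABC.ABC.Theorems

open Literature.NumberTheory.DiophantineGeometry

/-- Monotonicity of the Stewart–Yu exponent: for `2 ≤ r ≤ P`, `C ≤ κ` and `0 ≤ κ` one has
`C · r^{1/3} · (log r)^3 ≤ κ · P^{1/3} · (log P)^3`. [folklore] -/
theorem ScaleSubmultiplicativity.StewartYu.exponent_mono {C κ r P : ℝ} (hC : C ≤ κ) (hκ : 0 ≤ κ)
    (hr : 2 ≤ r) (hrP : r ≤ P) :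
    C * r ^ ((1 : ℝ) / 3) * Real.log r ^ (3 : ℕ) ≤ κ * P ^ ((1 : ℝ) / 3) * Real.log P ^ (3 : ℕ) := by
  have hr0 : 0 ≤ r := zero_le_two.trans hr
  have hP0 : 0 ≤ P := hr0.trans hrP
  have hlogr0 : 0 ≤ Real.log r := Real.log_nonneg (one_le_two.trans hr)
  have hlogrP : Real.log r ≤ Real.log P := Real.log_le_log (two_pos.trans_le hr) hrP
  have hrpow0 : 0 ≤ r ^ ((1 : ℝ) / 3) := Real.rpow_nonneg hr0 _
  have hPpow0 : 0 ≤ P ^ ((1 : ℝ) / 3) := Real.rpow_nonneg hP0 _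
  have hrpowP : r ^ ((1 : ℝ) / 3) ≤ P ^ ((1 : ℝ) / 3) := Real.rpow_le_rpow hr0 hrP (by norm_num)
  have hlog3 : Real.log r ^ (3 : ℕ) ≤ Real.log P ^ (3 : ℕ) := pow_le_pow_left₀ hlogr0 hlogrP 3
  have hlog30 : 0 ≤ Real.log r ^ (3 : ℕ) := pow_nonneg hlogr0 3
  calc C * r ^ ((1 : ℝ) / 3) * Real.log r ^ (3 : ℕ)
        = C * (r ^ ((1 : ℝ) / 3) * Real.log r ^ (3 : ℕ)) := mul_assoc _ _ _
    _ ≤ κ * (r ^ ((1 : ℝ) / 3) * Real.log r ^ (3 : ℕ)) :=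
        mul_le_mul_of_nonneg_right hC (mul_nonneg hrpow0 hlog30)
    _ = κ * r ^ ((1 : ℝ) / 3) * Real.log r ^ (3 : ℕ) := (mul_assoc _ _ _).symm
    _ ≤ κ * P ^ ((1 : ℝ) / 3) * Real.log P ^ (3 : ℕ) :=
        mul_le_mul (mul_le_mul_of_nonneg_left hrpowP hκ) hlog3 hlog30 (mul_nonneg hκ hPpow0)

/-- The `c`-value of an abc triple is at least `1` (indeed `c = a + b ≥ 2`), as a real
inequality. [folklore] -/
theorem ScaleSubmultiplicativity.StewartYu.one_le_cast_c {a b c : ℕ} (h : IsABCTriple a b c) :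
    (1 : ℝ) ≤ (c : ℝ) := by
  obtain ⟨ha, -, hsum, -⟩ := h
  exact_mod_cast (show 1 ≤ c by omega)

/-- **Stub S3 (`stewartYu_slack_submult`), the Stewart–Yu calibration.**  Given abc.S06
(`stewart_yu`: `log c ≤ C · rad^{1/3} · (log rad)^3` for every abc triple), there is `κ > 0` such
that for all `R₁, R₂ ≥ 4` every abc triple with `rad ≤ R₁R₂` satisfies
`c ≤ 16 · exp(κ (R₁R₂)^{1/3} (log R₁R₂)^3) · c₁ c₂` for some abc triples `(aᵢ, bᵢ, cᵢ)` with
`rad ≤ Rᵢ` — the crux inequality of `ScaleSubmultiplicativity` with the Stewart–Yu slack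
(`κ = max C 1`; witnesses `(1, 2ⁿ - 1, 2ⁿ)` from `SubmultOfRST.exists_triple_at_scale`).
[cite: StewartYu2001, Theorem 1] -/
theorem ScaleSubmultiplicativity.stewartYu_slack_submult :
    Literature.NumberTheory.DiophantineGeometry.stewart_yu →
      ∃ κ : ℝ, 0 < κ ∧ ∀ R₁ R₂ : ℕ, 4 ≤ R₁ → 4 ≤ R₂ → ∀ a b c : ℕ, IsABCTriple a b c →
        rad a b c ≤ R₁ * R₂ →
        ∃ a₁ b₁ c₁ a₂ b₂ c₂ : ℕ, IsABCTriple a₁ b₁ c₁ ∧ rad a₁ b₁ c₁ ≤ R₁ ∧ IsABCTriple a₂ b₂ c₂ ∧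
          rad a₂ b₂ c₂ ≤ R₂ ∧
          (c : ℝ) ≤ 16 * Real.exp (κ * ((R₁ : ℝ) * R₂) ^ ((1 : ℝ) / 3) *
            Real.log ((R₁ : ℝ) * R₂) ^ (3 : ℕ)) * c₁ * c₂ := by
  rintro ⟨C, hC⟩
  refine ⟨max C 1, lt_max_of_lt_right one_pos, ?_⟩
  intro R₁ R₂ hR₁ hR₂ a b c habc hrad
  obtain ⟨a₁, b₁, c₁, h₁, hrad₁, -⟩ := SubmultOfRST.exists_triple_at_scale hR₁
  obtain ⟨a₂, b₂, c₂, h₂, hrad₂, -⟩ := SubmultOfRST.exists_triple_at_scale hR₂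
  refine ⟨a₁, b₁, c₁, a₂, b₂, c₂, h₁, hrad₁, h₂, hrad₂, ?_⟩
  -- the Stewart–Yu exponent at scale `R₁ R₂`
  set E : ℝ := max C 1 * ((R₁ : ℝ) * R₂) ^ ((1 : ℝ) / 3) * Real.log ((R₁ : ℝ) * R₂) ^ (3 : ℕ)
    with hE_def
  have hrad2 : (2 : ℝ) ≤ ((rad a b c : ℕ) : ℝ) := by exact_mod_cast SubmultOfRST.two_le_rad habc
  have hradP : ((rad a b c : ℕ) : ℝ) ≤ (R₁ : ℝ) * R₂ := by exact_mod_cast hrad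
  have hlogc : Real.log (c : ℝ) ≤ E :=
    (hC a b c habc).trans (ScaleSubmultiplicativity.StewartYu.exponent_mono (le_max_left C 1)
      (zero_le_one.trans (le_max_right C 1)) hrad2 hradP)
  have hc0 : (0 : ℝ) < (c : ℝ) :=
    one_pos.trans_le (ScaleSubmultiplicativity.StewartYu.one_le_cast_c habc)
  have hcE : (c : ℝ) ≤ Real.exp E :=
    calc (c : ℝ) = Real.exp (Real.log (c : ℝ)) := (Real.exp_log hc0).symm
      _ ≤ Real.exp E := Real.exp_le_exp.mpr hlogc
  -- the witnesses have `cᵢ ≥ 1`, so `exp E ≤ 16 · exp E · c₁ c₂`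
  have h16 : (1 : ℝ) ≤ 16 * (c₁ : ℝ) * c₂ :=
    calc (1 : ℝ) ≤ (c₁ : ℝ) * c₂ :=
          one_le_mul_of_one_le_of_one_le (ScaleSubmultiplicativity.StewartYu.one_le_cast_c h₁)
            (ScaleSubmultiplicativity.StewartYu.one_le_cast_c h₂)
      _ ≤ 16 * ((c₁ : ℝ) * c₂) := le_mul_of_one_le_left (by positivity) (by norm_num)
      _ = 16 * (c₁ : ℝ) * c₂ := (mul_assoc _ _ _).symm
  calc (c : ℝ) ≤ Real.exp E := hcE
    _ = Real.exp E * 1 := (mul_one _).symm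
    _ ≤ Real.exp E * (16 * (c₁ : ℝ) * c₂) := mul_le_mul_of_nonneg_left h16 (Real.exp_pos E).le
    _ = 16 * Real.exp E * c₁ * c₂ := by ring

end Summit.ABC.ABC.Theorems
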